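import Literature.AlgebraicGeometry.Frobenioids.ArchimedeanPerfectionRadialLevel
import HarnessLib

/-!
# Frobenioids II, Thm. 3.6 (i) at `Λ = ℚ`, piece P2 (ii d): the radial section is independent of the Frobenius
# level (`σ₀^{(c·k)} = σ₀^{(c)}`)

Mochizuki, *The geometry of Frobenioids II: poly-Frobenioids*, Kyushu J. Math. **62** (2008) 401–460, §3,
Thm. 3.6 (i) p. 36 [cite: MochizukiFrdII2008, Thm 3.6 (i) p.36]; [FrdI] Def. 3.1 (ii)/(iii) p. 56–57, Prop. 4.4
p. 82 [cite: MochizukiFrdI2008, Def. 3.1 (iii) p.57].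

abc-iut cell, layer L1, row M13-c3 piece **P2** (seat abc-iut-w5-d246), file 2d of the P2 chain: with the refining
arrow `levelHom` of file 2c, the standard fraction of a positive real scalar `r` at level `c` and that of `r^k` at
level `c·k` are refinement-related (`mk_stdFrac_level`), whence **`radialSection_mul_eq`**: the radial sections
`σ₀ : ℝ_{≥0} →* O^×((A, n)^birat)` built at the naively isotropic levels `c` and `c·k` coincide — the radial germs
are canonical (the input for the transport of radial germs along linear arrows at adapted levels).
Proof-only; nothing here bears on [IUTchIII] Cor. 3.12.
-/

noncomputable section

namespace Literature.AlgebraicGeometry.Frobenioids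

open CategoryTheory Opposite
open scoped Pointwise NNReal

universe v u

namespace ArchFrd

namespace Thm36Sub

variable {D : Type u} [Category.{v} D] {π : D ⥤ D0}

open PreFrobenioid PreFrobenioid.Perfection

section LevelEq

variable {hF : PreFrobenioid.IsFrobenioid (C.toElem π)} (X : pfCat π hF)
  (hPf : PreFrobenioid.IsFrobenioid (pfStr π hF)) {c k : ℕ+} (hc : (frobPow hF X.obj c).fst.IsNaivelyIsotropic)
  (hck : (frobPow hF X.obj (c * k)).fst.IsNaivelyIsotropic) {t : PosReal} (ht : (t : ℝ) ≤ (frobPow hF X.obj c).fst.tip)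

/-- The refining arrow `disc_{t′} → (disc_t)^{(k)}` is a co-angular pre-step of `C` (degree `1`, invertible base,
source and target naively isotropic). [cite: MochizukiFrdII2008, Ex 3.3 (ii) p.28] -/
theorem isCoAngularPreStep_levelHom (t' : PosReal)
    (h' : ‖(levelScalar X hc k ht : ℂ)‖ * t' ≤ (frobPow hF (disc (frobPow hF X.obj c) t) k).fst.tip) :
    PreFrobenioid.IsCoAngularPreStep (C.toElem π) (levelHom X hc ht t' h') := by
  haveI := isIso_snd_liftK X k (isCoAngularPreStep_discIncl hc t 1 (one_mem _) (norm_one_mul_le ht))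
  refine ⟨(Ex33ii_coAngular_iff_holds π (levelHom X hc ht t' h')).mpr ?_, rfl, ?_⟩
  · intro _
    rw [C0.image_unitPart_homImage, C0.image_unitPart_pullRegion, degFr_levelHom,
      show (frobPow hF (disc (frobPow hF X.obj c) t) k).fst.region.dir = Set.univ from
        isNaivelyIsotropic_of_hom_disc (frob hF (disc (frobPow hF X.obj c) t) k)]
    change unitPart ℂ _ • (Set.univ : Set (normOneSubgroup ℂ)) ^ ((1 : ℕ+) : ℕ) = _
    rw [PNat.one_coe, pow_one, Set.smul_set_univ, Set.image_univ]
    exact (Function.Surjective.range_eq fun (w : normOneSubgroup ℂ) =>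
      ⟨unitPart ℂ ((C0.Base (levelHom X hc ht t' h').fst).act (w : ℂˣ)), C0.twist_twist _ w⟩).symm
  · change IsIso (levelHom X hc ht t' h').snd
    rw [levelHom_snd]
    infer_instance

/-- **The level-change relation** (Def. 3.1 (ii)/(iii) + Prop. 4.4: equality in `Hom^birat`): the standard fraction
of `r^k` at level `c·k` (radius `t′`) and the standard fraction of `r` at level `c` (radius `t`) have the same class
in `O^×((A, n)^birat)` — refine the latter along `frob⁻¹ ≫ levelHom : (disc_{t′}, n c k) → (disc_t, n c)`.
[cite: MochizukiFrdI2008, Prop. 4.4 p.82] -/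
theorem mk_stdFrac_level (r : PosReal) (h : ‖((ofPosReal ℂ r : ℂˣ) : ℂ)‖ * t ≤ (frobPow hF X.obj c).fst.tip)
    (t' : PosReal) (ht' : (t' : ℝ) ≤ (frobPow hF X.obj (c * k)).fst.tip)
    (hk : ‖((ofPosReal ℂ r ^ (k : ℕ) : ℂˣ) : ℂ)‖ * t' ≤ (frobPow hF X.obj (c * k)).fst.tip)
    (h' : ‖(levelScalar X hc k ht : ℂ)‖ * t' ≤ (frobPow hF (disc (frobPow hF X.obj c) t) k).fst.tip) :
    BiratUnits.mk hPf (stdFrac X (c * k) hck t' ht' (ofPosReal ℂ r ^ (k : ℕ))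
        (pow_mem (ofPosReal_mem_scalars _ _) _) hk) =
      BiratUnits.mk hPf (stdFrac X c hc t ht (ofPosReal ℂ r) (ofPosReal_mem_scalars _ _) h) := by
  haveI := Perfection.isIso_frob_one (hF := hF) (disc (frobPow hF X.obj (c * k)) t')
  have lvl : (discPf X (c * k) t').idx * 1 = (discPf X c t).idx * k := by
    change X.idx * (c * k) * 1 = X.idx * c * k
    rw [mul_one, mul_assoc]
  let εr : Rep (discPf X (c * k) t') (discPf X c t) :=
    ⟨⟨1, k, lvl⟩, frobOneInv (hF := hF) (disc (frobPow hF X.obj (c * k)) t') ≫ levelHom X hc ht t' h'⟩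
  have hε : PreFrobenioid.IsCoAngularPreStep (pfStr π hF) (Hom.mk εr) :=
    PerfectionBirat.isCoAngularPreStep_mk_of εr
      (PreFrobenioid.IsCoAngularPreStep.iso_comp (F := C.toElem π)
        (CategoryTheory.inv (frob hF (disc (frobPow hF X.obj (c * k)) t') 1)) (isCoAngularPreStep_levelHom X hc ht t' h'))
  let T : Level₃ (discPf X (c * k) t') (discPf X c t) X := ⟨1, k, c * k, lvl, mul_assoc _ _ _⟩
  -- the two composites `εr ≫ ι₁-arrow`, `εr ≫ ι_r-arrow`, computed at the triple level `(1, k, c k)`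
  have comp : ∀ (ι : disc (frobPow hF X.obj c) t ⟶ frobPow hF X.obj c),
      Hom.mk εr ≫ inclHom X c t ι = Hom.mk (⟨⟨1, c * k, mul_one _⟩,
        frobOneInv (hF := hF) (disc (frobPow hF X.obj (c * k)) t') ≫ levelHom X hc ht t' h' ≫ liftK X k ι⟩ :
          Rep (discPf X (c * k) t') X) := by
    intro ι
    rw [← mk_liftK X k ι, Perfection.mk_comp_mk, ← Perfection.mk_compAt T _ _ (Level.le_rfl _) (Level.le_rfl _)]
    refine Perfection.Hom.mk_eq_mk.mpr ⟨T.out, Level.le_rfl _, Level.le_rfl _, ?_⟩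
    unfold compAt
    change Level.lift (⟨1, c * k, mul_one _⟩ : Level (discPf X (c * k) t') X) ⟨1, c * k, mul_one _⟩ (Level.le_rfl _)
        (Level.lift (⟨1, k, lvl⟩ : Level (discPf X (c * k) t') (discPf X c t)) ⟨1, k, lvl⟩ (Level.le_rfl _)
            (frobOneInv (hF := hF) (disc (frobPow hF X.obj (c * k)) t') ≫ levelHom X hc ht t' h') ≫
          Level.lift (levelK X c k t) (levelK X c k t) (Level.le_rfl _) (liftK X k ι)) =
      Level.lift (⟨1, c * k, mul_one _⟩ : Level (discPf X (c * k) t') X) ⟨1, c * k, mul_one _⟩ (Level.le_rfl _)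
        (frobOneInv (hF := hF) (disc (frobPow hF X.obj (c * k)) t') ≫ levelHom X hc ht t' h' ≫ liftK X k ι)
    rw [Level.lift_rfl, Level.lift_rfl, Level.lift_rfl, Level.lift_rfl, Category.assoc]
  symm
  refine BiratUnits.sound ⟨discPf X (c * k) t', Hom.mk εr, 𝟙 _, hε, isCoAngularPreStep_id hPf _, ?_, ?_⟩
  · change Hom.mk εr ≫ inclHom X c t _ = 𝟙 _ ≫ inclHom X (c * k) t' _
    rw [comp, Category.id_comp, levelHom_comp_liftOne X hc hck ht t' h' ht']
    rfl
  · change Hom.mk εr ≫ inclHom X c t _ = 𝟙 _ ≫ inclHom X (c * k) t' _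
    rw [comp, Category.id_comp, levelHom_comp_liftK X hc hck ht t' h' r h hk]
    rfl

end LevelEq

/-- `exp(−(n·c·k)·a) = exp(−(n·c)·a)^k`. [cite: MochizukiFrdII2008, Def 3.1 (ii) p.23] -/
theorem ofPosReal_radialScalar_mul {hF : PreFrobenioid.IsFrobenioid (C.toElem π)} (X : pfCat π hF) (c k : ℕ+)
    (a : Multiplicative ℝ≥0) :
    ofPosReal ℂ (radialScalar X (c := c * k) a) = ofPosReal ℂ (radialScalar X (c := c) a) ^ (k : ℕ) := by
  rw [← map_pow]
  congr 1
  apply Subtype.ext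
  change Real.exp _ = Real.exp _ ^ (k : ℕ)
  rw [← Real.exp_nat_mul]
  congr 1
  push_cast
  ring

/-- **The radial section does not depend on the level**: `σ₀^{(c·k)} = σ₀^{(c)}` for naively isotropic levels
`c`, `c·k` of `A` ([FrdII] Thm. 3.6 (i): the rational function `e^{−a}` of `C^ℚ` at `(A, n)` is one element of
`O^×((A, n)^birat)`, however represented). [cite: MochizukiFrdII2008, Thm 3.6 (i) p.36] -/
theorem radialSection_mul_eq {hF : PreFrobenioid.IsFrobenioid (C.toElem π)} (X : pfCat π hF)
    (hPf : PreFrobenioid.IsFrobenioid (pfStr π hF)) {c k : ℕ+} (hc : (frobPow hF X.obj c).fst.IsNaivelyIsotropic)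
    (hck : (frobPow hF X.obj (c * k)).fst.IsNaivelyIsotropic) :
    radialSection X hPf (c := c * k) hck = radialSection X hPf (c := c) hc := by
  refine MonoidHom.ext fun a => ?_
  rw [radialSection_apply, radialSection_apply,
    germ_congr X hPf hck (ofPosReal_radialScalar_mul X c k a) _ (pow_mem (ofPosReal_mem_scalars _ _) _)]
  set r := radialScalar X (c := c) a
  -- a radius small enough for the refining arrow and for the standard fraction at level `c·k`
  let t : PosReal := rad (frobPow hF X.obj c) (ofPosReal ℂ r)
  have ht : (t : ℝ) ≤ (frobPow hF X.obj c).fst.tip := rad_le _ _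
  let t₁ : PosReal := rad (frobPow hF X.obj (c * k)) (ofPosReal ℂ r ^ (k : ℕ))
  let t₂ : PosReal := rad (frobPow hF (disc (frobPow hF X.obj c) t) k) (levelScalar X hc k ht)
  let t' : PosReal := ⟨min (t₁ : ℝ) (t₂ : ℝ), lt_min t₁.2 t₂.2⟩
  have h1 : (t' : ℝ) ≤ t₁ := min_le_left _ _
  have h2 : (t' : ℝ) ≤ t₂ := min_le_right _ _
  have ht' : (t' : ℝ) ≤ (frobPow hF X.obj (c * k)).fst.tip := h1.trans (rad_le _ _)
  have hk : ‖((ofPosReal ℂ r ^ (k : ℕ) : ℂˣ) : ℂ)‖ * t' ≤ (frobPow hF X.obj (c * k)).fst.tip :=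
    (mul_le_mul_of_nonneg_left h1 (norm_nonneg _)).trans (norm_mul_rad_le _ _)
  have h' : ‖(levelScalar X hc k ht : ℂ)‖ * t' ≤ (frobPow hF (disc (frobPow hF X.obj c) t) k).fst.tip :=
    (mul_le_mul_of_nonneg_left h2 (norm_nonneg _)).trans (norm_mul_rad_le _ _)
  rw [germ_eq_mk_stdFrac X hPf hck _ _ t' ht' hk]
  exact mk_stdFrac_level X hPf hc hck ht r (norm_mul_rad_le _ _) t' ht' hk h'

end Thm36Sub

end ArchFrd

end Literature.AlgebraicGeometry.Frobenioids

end
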